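import Summits.AnomalousDissipation.AnomalousDissipation.Theorems.SolenoidalFractalHomogenisationLagrangianStepSidebandXResidualBound
import Summits.AnomalousDissipation.AnomalousDissipation.Theorems.SolenoidalFractalHomogenisationLagrangianStepSidebandXSlowAveragingWeighted
import HarnessLib

/-!
# K1L_D `LagrangianRenormalisationStepDesign` (stmt-AnomalousDissipation-27980), `stub_D1_V0R` (ruling D27-1), brick T8c: THE MASTER
# AVERAGING ESTIMATE for the slow mode of the single-mode datum — `‖x(t) − e^{−tḠ}x(0)‖ ≤ M·Γ(t)` with an explicit, ν-uniform `Γ`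
# (helper; `--kind proof --supports stmt-AnomalousDissipation-27980 --as helper`)

Summits-side helper file of route `SolenoidalFractalHomogenisation` (prover seat `ad-k1l-cellLawV-w1` g7; 0 sorry, no defs, no named facts).
`…SlowAveragingWeighted.norm_modeRep_sub_exp_le_weighted` (first-order averaging of the slow equation against an abstract coercive `Ḡ` whose
transversal action is `4π²P_ℓT_𝔹ᵀ(ℓ) + slowMean`) + `…ResidualBound.forcing_integral_le_single` (the weighted forcing budget) give, for the
datum `Re e_ℓ·p` and every `t ∈ [0,T]`:
`‖x(t) − exp(−tḠ)x(0)‖ ≤ M·L·P₁·(1 + (2Gn + L)/r_lo) + (1 + L·P₁)·ξ·Cf·M·(ξ·CN·min(t, 8/(π²lo)) + (√ρ₂ + 2ξ²CN)·min(t, 1/r_lo))`,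
`L = 2ξ²·Cf·CN`, `P₁ = W₁.period`, `CN = Σ8π‖αⱼ‖/min(1,4π²lo)`, `Cf = Σ4π‖αⱼ‖`, `ρ₂` of `…ResidualBound` (sizes at `lo ∼ ν`, `P₁ ∼ 1/ν`,
`r_lo ∼ ξ²/ν`: first term `∼ ξ²/ν²`, second `∼ (ξ/ν + ξ + …)·min(1, r_lo t)` — uniform in `ν` at fixed `ξ/ν`).
What remains for `stub_D1_V0R` (next seat): instantiate `Ḡ := effGenC ((1/n²)•(𝔸 + (1/ν)•Ψ⋆)) ℓ r₁` (`…EffGen*`, `…EffGenCoercive`,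
`…PsiStarLower`), identify `exp(−tḠ)x(0)` with the effective mode (`…EffMode.exp_effGenC_realVec_eq`, `LagrangianStep.effective_modeCoeff_eq`),
and repackage `Γ` in the clause currency (`σ = 1`, `c = 1/a`).
NOT a proof of any registered stub, of K1L_D, or of anomalous dissipation; rung F-D1.A0 infrastructure.
-/

set_option linter.dupNamespace false

noncomputable section

namespace Summit.AnomalousDissipation.AnomalousDissipation.Theorems.SolenoidalFractalHomogenisation.LagrangianStep.Sideband

open Set MeasureTheory Complex UnitAddTorus intervalIntegral NormedSpace
open scoped InnerProductSpace
open Literature.Analysis Literature.Analysis.FunctionSpaces Literature.Analysis.FunctionSpaces.Torus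
open Literature.Analysis.FluidPDE Literature.Analysis.FluidPDE.Torus Literature.Analysis.FluidPDE.LatticeShear
open Summit.AnomalousDissipation.AnomalousDissipation.Theorems.SolenoidalFractalHomogenisation.LagrangianStep.CellChain (modeRep)
open Summit.AnomalousDissipation.AnomalousDissipation.Theorems.SolenoidalFractalHomogenisation.RealisedQuasiStaticCellLaw
  (memLp_two_of_memSobolev_one_complexify memSobolev_one_singleMode)
open Summit.AnomalousDissipation.AnomalousDissipation.Theorems.SolenoidalFractalHomogenisation.PermissibleCarrier (period_pos)

variable {k₀ : ℕ}

/-- Monotone combination step (abstract atoms). [folklore] -/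
theorem master_combine {D A c I B : ℝ} (h1 : D ≤ A + c * I) (hc : 0 ≤ c) (h2 : I ≤ B) : D ≤ A + c * B := by
  nlinarith [mul_le_mul_of_nonneg_left h2 hc]

/-- **THE MASTER AVERAGING ESTIMATE** (single-mode datum `Re e_ℓ·p`, `p ⊥ ℓ`, `ℓ ≠ 0`, `2|ℓ| < n`; tensor `(1/n²)•𝔸`, `NearIso 𝔸 lo hi`,
`OddSmall 𝔸 β`; `1 ≤ R`, `max|mⱼ|_∞ ≤ Mm ≤ R`; a priori bound `M`; smallness `2E_zξ⁴ ≤ π²lo/4`; abstract coercive `Ḡ` with rate `r_lo`, norm `≤ Gn`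
and transversal action `4π²P_ℓT_𝔹ᵀ(ℓ) + slowMean`): see the module docstring for the bound.
[cite: SandersVerhulstMurdock2007, Lemma 5.2.7 (linear case)] [cite: Hale1980, Ch. V §3 Lemma 3.2] [cite: BedrossianCotiZelati2017, §2] -/
theorem norm_modeRep_sub_exp_le_master (W₁ : LatticeWord k₀) {lo hi β : ℝ} (hlo : 0 < lo) (hhi : 0 ≤ hi) (hβ : 0 ≤ β) {n : ℕ} (hn : n ≠ 0)
    {T : ℝ} (hT : 0 < T) {𝔸 : Torus.Visc4 (Fin 3)} (h𝔸 : Torus.NearIso 𝔸 lo hi) (hodd : Torus.OddSmall 𝔸 β)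
    {ℓ : Fin 3 → ℤ} (hℓ0 : ℓ ≠ 0) (hℓ : 2 * Real.sqrt (freqNormSq ℓ) < n) {p : EuclideanSpace ℝ (Fin 3)} (hp : ⟪p, Torus.latticeVec ℓ⟫_ℝ = 0)
    {w : ℝ → UnitAddTorus (Fin 3) → EuclideanSpace ℝ (Fin 3)}
    (h : Torus.IsWeakTensorPassiveVectorOn 0 T ((1 / (n : ℝ) ^ 2) • 𝔸) (W₁.cell n) (fun x => (UnitAddTorus.mFourier ℓ x).re • p) w)
    {R Mm : ℕ} (hR : 1 ≤ R) (hMR : Mm ≤ R) (hM : ∀ j i, |(W₁.phase j).m i| ≤ (Mm : ℤ)) {M : ℝ}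
    (hxM : ∀ s ∈ Icc 0 T, ‖modeRep W₁ n ((1 / (n : ℝ) ^ 2) • 𝔸) (fun x => (UnitAddTorus.mFourier ℓ x).re • p) w ℓ s‖ ≤ M)
    (hE0 : (∫ x, ‖(UnitAddTorus.mFourier ℓ x).re • p‖ ^ 2) ≤ M ^ 2)
    (hsmall : 2 * (12 * (xiCN W₁ lo * xiCf W₁) ^ 2 / (Real.pi ^ 2 * lo)) * (Real.sqrt (freqNormSq ℓ) / n) ^ 4 ≤ Real.pi ^ 2 * lo / 4)
    (G : EuclideanSpace ℂ (Fin 3) →L[ℝ] EuclideanSpace ℂ (Fin 3)) {rlo Gn : ℝ} (hrlo : 0 < rlo)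
    (hcoer : ∀ v : EuclideanSpace ℂ (Fin 3), rlo * ‖v‖ ^ 2 ≤ ⟪G v, v⟫_ℝ) (hGn : ‖G‖ ≤ Gn)
    (hGx : ∀ v : EuclideanSpace ℂ (Fin 3), transversalProj ℓ v = v →
      G v = (((4 * Real.pi ^ 2 : ℝ) : ℂ)) • transversalProj ℓ (Torus.symbT (Torus.majorTranspose ((1 / (n : ℝ) ^ 2) • 𝔸)) ℓ v) +
        slowMean W₁ n ℓ 𝔸 R v)
    {t : ℝ} (ht : t ∈ Icc 0 T) :
    ‖modeRep W₁ n ((1 / (n : ℝ) ^ 2) • 𝔸) (fun x => (UnitAddTorus.mFourier ℓ x).re • p) w ℓ t - exp (-(t • G)) (modeRep W₁ n ((1 / (n : ℝ) ^ 2) • 𝔸) (fun x => (UnitAddTorus.mFourier ℓ x).re • p) w ℓ 0)‖ ≤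
      M * (2 * ((Real.sqrt (freqNormSq ℓ) / n) ^ 2 * (∑ j, 4 * Real.pi * ‖slotAmp W₁ j‖) * (∑ j, 8 * Real.pi * ‖slotAmp W₁ j‖ / min 1 (4 * Real.pi ^ 2 * lo))) * W₁.period * (1 + (2 * Gn + 2 * ((Real.sqrt (freqNormSq ℓ) / n) ^ 2 * (∑ j, 4 * Real.pi * ‖slotAmp W₁ j‖) * (∑ j, 8 * Real.pi * ‖slotAmp W₁ j‖ / min 1 (4 * Real.pi ^ 2 * lo)))) / rlo)) + (1 + 2 * ((Real.sqrt (freqNormSq ℓ) / n) ^ 2 * (∑ j, 4 * Real.pi * ‖slotAmp W₁ j‖) * (∑ j, 8 * Real.pi * ‖slotAmp W₁ j‖ / min 1 (4 * Real.pi ^ 2 * lo))) * W₁.period) * ((Real.sqrt (freqNormSq ℓ) / n) * (∑ j, 4 * Real.pi * ‖slotAmp W₁ j‖) * M * ((Real.sqrt (freqNormSq ℓ) / n) * xiCN W₁ lo * min t (1 / (Real.pi ^ 2 * lo / 8)) + (Real.sqrt (((Real.sqrt (freqNormSq ℓ) / n) ^ 4 * (xiCN W₁ lo ^ 2 * ((32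 * Real.pi ^ 2 * 534 ^ 2 * (hi + β / 2) ^ 2 / lo + 24 * (∑ j, 2 * Real.pi * ‖slotAmp W₁ j‖ * (5 + 3 * Real.sqrt (freqNormSq (W₁.phase j).m))) ^ 2 / (Real.pi ^ 2 * lo)) + 2 * (12 * (xiCN W₁ lo * xiCf W₁) ^ 2 / (Real.pi ^ 2 * lo)) * (Real.sqrt (freqNormSq ℓ) / n) ^ 2) + (6 * (∑ j, 4 * Real.pi * ‖slotAmp W₁ j‖ / Real.sqrt (freqNormSq (W₁.phase j).m)) ^ 2 / (Real.pi ^ 2 * lo) + 12 * (xiCN W₁ lo * (4 * Real.pi ^ 2 * (hi + β / 2))) ^ 2 / (Real.pi ^ 2 * lo))) + 2 / lo * ((4 * k₀ * (∑ j, ‖slotAmp W₁ j‖ ^ 2) * (k₀ * (∑ j, ‖slotAmp W₁ j‖ ^ 2) * (64 * (∑ j, ‖slotAmp W₁ j‖) ^ 2 / (Real.pi ^ 2 * lo ^ 2)) / (Real.pi ^ 2 * lo ^ 2 * (R : ℝ) ^ 2))) * (Real.sqrt (freqNormSq ℓ) / n) ^ 2)) / (Real.pi ^ 2 * lo / 4))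 + 2 * (Real.sqrt (freqNormSq ℓ) / n) ^ 2 * xiCN W₁ lo) * min t (1 / rlo))) := by
  have hn0 : (0 : ℝ) < n := by exact_mod_cast Nat.pos_of_ne_zero hn
  have hP := period_pos W₁
  have hFi : Integrable (fun x => (UnitAddTorus.mFourier ℓ x).re • p) volume :=
    (memLp_two_of_memSobolev_one_complexify (memSobolev_one_singleMode ℓ p)).integrable one_le_two
  have hbox : ∀ j, (W₁.phase j).m ∈ box R := fun j =>
    mem_box.2 ⟨fun i => by
      have h1 := abs_le.1 (hM j i); have h2 : (Mm : ℤ) ≤ R := (by exact_mod_cast hMR); constructor <;> omega, (W₁.phase j).m_ne⟩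
  have hCf0 : 0 ≤ (∑ j, 4 * Real.pi * ‖slotAmp W₁ j‖) := Finset.sum_nonneg fun j _ => by positivity
  have hCNL0 : 0 ≤ (∑ j, 8 * Real.pi * ‖slotAmp W₁ j‖ / min 1 (4 * Real.pi ^ 2 * lo)) := Finset.sum_nonneg fun j _ => by positivity
  have h1 := norm_modeRep_sub_exp_le_weighted W₁ h𝔸 hlo h hFi hbox G hrlo hcoer hGn hGx ht (fun s hs => hxM s ⟨hs.1, hs.2.trans ht.2⟩)
  have h2 := forcing_integral_le_single W₁ hlo hhi hβ hn hT h𝔸 hodd hℓ0 hℓ hp h hR hMR hM hxM hE0 hsmall hrlo ht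
  have hc : 0 ≤ 1 + 2 * ((Real.sqrt (freqNormSq ℓ) / n) ^ 2 * (∑ j, 4 * Real.pi * ‖slotAmp W₁ j‖) * (∑ j, 8 * Real.pi * ‖slotAmp W₁ j‖ / min 1 (4 * Real.pi ^ 2 * lo))) * W₁.period := by positivity
  exact master_combine h1 hc h2

end Summit.AnomalousDissipation.AnomalousDissipation.Theorems.SolenoidalFractalHomogenisation.LagrangianStep.Sideband

end
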